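import Summits.QuantumFields.YangMills.Theorems.ToronValleyVolumeZeroModeSymmetrisation

/-!
# Zero-mode quartic of the toron valley, III: rotation onto the axis, anisotropic rescaling, 1-D estimates

(1) `Φ±(β,a) = Φ±(β, ‖a‖e₃)` (a reflection applied to all columns is measure preserving and fixes `Q`);
(2) the diagonal map `diag(s,s,t)` on `ℝ³` applied to the three columns, its determinant `(s²t)³`, and the change of variables
`∫ g(Λy) dy = |det Λ|⁻¹ ∫ g`; scaling of the planar square and of the cross term;
(3) the two one-dimensional radial estimates: `∫_{r>0} r² u(r) dr ≤ Vρ¹²/12 + Kβ⁻³(log ρ⁻¹ + e^{1/2})` for the upper profile and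
`∫_{r>0} r² 𝟙_{[ρ',r₁]} (rβ)⁻³ dr = β⁻³ log(r₁/ρ')`.

HONEST LABEL: helper analysis for a plan-only BC5 rung (`stub_rung_zeroModeLog4`) of crux ⟨stmt-QuantumFields-24497⟩ on a
DRAFT-by-design sub-route (`ToronValleyVolume`, LINE g15-B of ym-idea-4); it is NOT in the crux composition; no crux, rung of the
ladder, leaf or summit statement is proved here; the Yang–Mills mass gap is NOT proved by this.
-/

noncomputable section

namespace Summit.QuantumFields.YangMills.Theorems.ToronValleyVolume.ZeroMode

open MeasureTheory Real Finset Set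
open scoped ENNReal
open Summit.QuantumFields.YangMills.Cruxes.ToronTubeVolumeLaw.Birth

/-! ## §7 Rotating the last column onto the axis; anisotropic linear rescaling -/

/-- A linear isometry applied to all three columns is measure preserving on `(ℝ³)³`. -/
theorem measurePreserving_columns (R : EuclideanSpace ℝ (Fin 3) ≃ₗᵢ[ℝ] EuclideanSpace ℝ (Fin 3)) :
    MeasurePreserving (fun (x : Fin 3 → EuclideanSpace ℝ (Fin 3)) (μ : Fin 3) => R (x μ)) volume volume := by
  have h := measurePreserving_pi (fun _ : Fin 3 => (volume : Measure (EuclideanSpace ℝ (Fin 3))))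
    (fun _ => (volume : Measure (EuclideanSpace ℝ (Fin 3)))) (f := fun _ => R) (fun _ => R.measurePreserving)
  exact h

/-- ROTATION INVARIANCE of `Φ⁺`: `Φ⁺(β, a) = Φ⁺(β, R a)` for a linear isometry `R`. -/
theorem PhiP_map (β : ℝ) (R : EuclideanSpace ℝ (Fin 3) ≃ₗᵢ[ℝ] EuclideanSpace ℝ (Fin 3)) (a : EuclideanSpace ℝ (Fin 3)) :
    PhiP β a = PhiP β (R a) := by
  unfold PhiP
  rw [← (measurePreserving_columns R).lintegral_comp (((measurable_G4 β (R a))).indicator (measurableSet_boxLe _))]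
  refine lintegral_congr fun x => ?_
  have hmem : (fun μ => R (x μ)) ∈ boxLe (R a) ↔ x ∈ boxLe a := by simp [boxLe, R.norm_map]
  by_cases hx : x ∈ boxLe a
  · rw [indicator_of_mem hx, indicator_of_mem (hmem.2 hx)]
    unfold G4
    rw [show (Fin.snoc (fun μ => R (x μ)) (R a) : Fin 4 → EuclideanSpace ℝ (Fin 3)) =
        fun μ => R ((Fin.snoc x a : Fin 4 → EuclideanSpace ℝ (Fin 3)) μ) from (Fin.comp_snoc R x a).symm,
      zmI_map]
  · rw [indicator_of_notMem hx, indicator_of_notMem (fun h => hx (hmem.1 h))]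

/-- ROTATION INVARIANCE of `Φ⁻`. -/
theorem PhiM_map (β : ℝ) (R : EuclideanSpace ℝ (Fin 3) ≃ₗᵢ[ℝ] EuclideanSpace ℝ (Fin 3)) (a : EuclideanSpace ℝ (Fin 3)) :
    PhiM β a = PhiM β (R a) := by
  unfold PhiM
  rw [← (measurePreserving_columns R).lintegral_comp (((measurable_G4 β (R a))).indicator (measurableSet_boxLt _))]
  refine lintegral_congr fun x => ?_
  have hmem : (fun μ => R (x μ)) ∈ boxLt (R a) ↔ x ∈ boxLt a := by simp [boxLt, R.norm_map]
  by_cases hx : x ∈ boxLt a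
  · rw [indicator_of_mem hx, indicator_of_mem (hmem.2 hx)]
    unfold G4
    rw [show (Fin.snoc (fun μ => R (x μ)) (R a) : Fin 4 → EuclideanSpace ℝ (Fin 3)) =
        fun μ => R ((Fin.snoc x a : Fin 4 → EuclideanSpace ℝ (Fin 3)) μ) from (Fin.comp_snoc R x a).symm,
      zmI_map]
  · rw [indicator_of_notMem hx, indicator_of_notMem (fun h => hx (hmem.1 h))]

/-- There is a linear isometry taking `a` to `‖a‖ • e₃` (a reflection). -/
theorem exists_isometry_map_eq_smul_e3 (a : EuclideanSpace ℝ (Fin 3)) :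
    ∃ R : EuclideanSpace ℝ (Fin 3) ≃ₗᵢ[ℝ] EuclideanSpace ℝ (Fin 3), R a = ‖a‖ • e3 := by
  have h : ‖a‖ = ‖(‖a‖ • e3 : EuclideanSpace ℝ (Fin 3))‖ := by
    rw [norm_smul, norm_e3, mul_one, Real.norm_eq_abs, abs_norm]
  exact ⟨_, Submodule.reflection_sub h⟩

/-- `Φ⁺(β,a) = Φ⁺(β, ‖a‖e₃)`. -/
theorem PhiP_eq_axis (β : ℝ) (a : EuclideanSpace ℝ (Fin 3)) : PhiP β a = PhiP β (‖a‖ • e3) := by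
  obtain ⟨R, hR⟩ := exists_isometry_map_eq_smul_e3 a
  rw [PhiP_map β R a, hR]

/-- `Φ⁻(β,a) = Φ⁻(β, ‖a‖e₃)`. -/
theorem PhiM_eq_axis (β : ℝ) (a : EuclideanSpace ℝ (Fin 3)) : PhiM β a = PhiM β (‖a‖ • e3) := by
  obtain ⟨R, hR⟩ := exists_isometry_map_eq_smul_e3 a
  rw [PhiM_map β R a, hR]

/-- Coordinates `ℝ³ ≃ ℝ³` (WithLp bookkeeping). -/
def eX : (Fin 3 → ℝ) ≃ₗ[ℝ] EuclideanSpace ℝ (Fin 3) := (WithLp.linearEquiv 2 ℝ (Fin 3 → ℝ)).symm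

/-- The anisotropic diagonal map `diag(s, s, t)` on `ℝ³`. -/
def diag3 (s t : ℝ) : EuclideanSpace ℝ (Fin 3) →ₗ[ℝ] EuclideanSpace ℝ (Fin 3) :=
  eX.toLinearMap ∘ₗ (Matrix.toLin' (Matrix.diagonal ![s, s, t]) ∘ₗ eX.symm.toLinearMap)

/-- Auxiliary: `diag3_apply_zero`. -/
@[simp] theorem diag3_apply_zero (s t : ℝ) (u : EuclideanSpace ℝ (Fin 3)) : (diag3 s t u) 0 = s * u 0 := by
  simp [diag3, eX, Matrix.toLin'_apply, Matrix.mulVec_diagonal]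

/-- Auxiliary: `diag3_apply_one`. -/
@[simp] theorem diag3_apply_one (s t : ℝ) (u : EuclideanSpace ℝ (Fin 3)) : (diag3 s t u) 1 = s * u 1 := by
  simp [diag3, eX, Matrix.toLin'_apply, Matrix.mulVec_diagonal]

/-- Auxiliary: `diag3_apply_two`. -/
@[simp] theorem diag3_apply_two (s t : ℝ) (u : EuclideanSpace ℝ (Fin 3)) : (diag3 s t u) 2 = t * u 2 := by
  simp [diag3, eX, Matrix.toLin'_apply, Matrix.mulVec_diagonal]

/-- `det diag(s,s,t) = s² t`. -/
theorem det_diag3 (s t : ℝ) : LinearMap.det (diag3 s t) = s * s * t := by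
  unfold diag3
  rw [LinearMap.det_conj (Matrix.toLin' (Matrix.diagonal ![s, s, t])) eX, LinearMap.det_toLin',
    Matrix.det_diagonal, Fin.prod_univ_three]
  simp

/-- The rescaling applied to all three columns. -/
def Lam (s t : ℝ) : (Fin 3 → EuclideanSpace ℝ (Fin 3)) →ₗ[ℝ] (Fin 3 → EuclideanSpace ℝ (Fin 3)) :=
  LinearMap.pi (fun μ => diag3 s t ∘ₗ LinearMap.proj μ)

/-- Auxiliary: `Lam_apply`. -/
@[simp] theorem Lam_apply (s t : ℝ) (x : Fin 3 → EuclideanSpace ℝ (Fin 3)) (μ : Fin 3) :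
    Lam s t x μ = diag3 s t (x μ) := by simp [Lam]

/-- `det Λ(s,t) = (s² t)³`. -/
theorem det_Lam (s t : ℝ) : LinearMap.det (Lam s t) = (s * s * t) ^ 3 := by
  unfold Lam; rw [LinearMap.det_pi]; simp [det_diag3]

/-- CHANGE OF VARIABLES under `Λ(s,t)` (`s, t ≠ 0`): `∫ g(Λy) dy = |det Λ|⁻¹ ∫ g`. -/
theorem lintegral_comp_Lam {s t : ℝ} (hs : s ≠ 0) (ht : t ≠ 0)
    (g : (Fin 3 → EuclideanSpace ℝ (Fin 3)) → ℝ≥0∞) (hg : Measurable g) :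
    ∫⁻ y, g (Lam s t y) = ENNReal.ofReal (|(s * s * t) ^ 3|⁻¹) * ∫⁻ y, g y := by
  have hdet : LinearMap.det (Lam s t) ≠ 0 := by rw [det_Lam]; positivity
  have hΛ : Measurable (Lam s t) := (LinearMap.continuous_of_finiteDimensional _).measurable
  rw [← lintegral_map hg hΛ, Measure.map_linearMap_addHaar_eq_smul_addHaar _ hdet, lintegral_smul_measure,
    det_Lam, smul_eq_mul, abs_inv]

/-- Scaling of the planar square: `plSq(diag(s,s,t)u) = s²·plSq(u)`. -/
theorem plSq_diag3 (s t : ℝ) (u : EuclideanSpace ℝ (Fin 3)) : plSq (diag3 s t u) = s ^ 2 * plSq u := by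
  unfold plSq; rw [diag3_apply_zero, diag3_apply_one]; ring

/-- Scaling of the cross term: `cr(Lu, Lv) = s²t²·cr(u,v)` for `L = diag(s,s,t)`. -/
theorem cr_diag3 (s t : ℝ) (u v : EuclideanSpace ℝ (Fin 3)) :
    cr (diag3 s t u) (diag3 s t v) = s ^ 2 * t ^ 2 * cr u v := by
  unfold cr; simp only [diag3_apply_zero, diag3_apply_one, diag3_apply_two]; ring


/-! ## §10 One-dimensional estimates -/

/-- For `r ≥ 1`: `exp(−r²/2)/r ≤ exp(1/2)·exp(−r)`. -/
theorem exp_neg_sq_half_div_le {r : ℝ} (hr : 1 ≤ r) :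
    Real.exp (-r ^ 2 / 2) / r ≤ Real.exp (1 / 2) * Real.exp (-r) := by
  rw [← Real.exp_add, div_le_iff₀ (by linarith)]
  have h1 : Real.exp (-r ^ 2 / 2) ≤ Real.exp (1 / 2 + -r) := Real.exp_le_exp.2 (by nlinarith)
  have h2 : Real.exp (1 / 2 + -r) ≤ Real.exp (1 / 2 + -r) * r :=
    le_mul_of_one_le_right (Real.exp_pos _).le hr
  exact h1.trans h2

/-- The UPPER radial profile `u(r) = exp(−r²/2)·(V r⁹ if r ≤ ρ, else Kr/(rβ)³)`. -/
def uprof (Kr V β ρ r : ℝ) : ℝ := Real.exp (-r ^ 2 / 2) * (if r ≤ ρ then V * r ^ 9 else Kr / (r * β) ^ 3)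

/-- Auxiliary: `uprof_nonneg`. -/
theorem uprof_nonneg {Kr V β ρ : ℝ} (hK : 0 ≤ Kr) (hV : 0 ≤ V) (hβ : 0 < β) {r : ℝ} (hr : 0 < r) :
    0 ≤ uprof Kr V β ρ r := by
  unfold uprof; split_ifs <;> positivity

/-- Auxiliary: `measurable_uprof`. -/
theorem measurable_uprof (Kr V β ρ : ℝ) : Measurable (uprof Kr V β ρ) := by
  unfold uprof
  refine (Real.continuous_exp.measurable.comp (by fun_prop)).mul ?_
  exact Measurable.ite measurableSet_Iic (by fun_prop) (by fun_prop)

/-- ★ 1-D UPPER ESTIMATE: `∫_{r>0} r² u(r) dr ≤ Vρ¹²/12 + (Kr/β³)(log ρ⁻¹ + e^{1/2})` (`0 < ρ ≤ 1`). -/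
theorem lintegral_uprof_le {Kr V β ρ : ℝ} (hK : 0 ≤ Kr) (hV : 0 ≤ V) (hβ : 0 < β) (hρ : 0 < ρ) (hρ1 : ρ ≤ 1) :
    ∫⁻ r in Ioi (0 : ℝ), ENNReal.ofReal (r ^ 2) * ENNReal.ofReal (uprof Kr V β ρ r) ≤
      ENNReal.ofReal (V * ρ ^ 12 / 12 + Kr / β ^ 3 * (Real.log ρ⁻¹ + Real.exp (1 / 2))) := by
  set f₁ : ℝ → ℝ≥0∞ := (Ioc 0 ρ).indicator fun r => ENNReal.ofReal (V * r ^ 11) with hf₁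
  set f₂ : ℝ → ℝ≥0∞ := (Ioc ρ 1).indicator fun r => ENNReal.ofReal (Kr / β ^ 3 * r⁻¹) with hf₂
  set f₃ : ℝ → ℝ≥0∞ := fun r => ENNReal.ofReal (Kr / β ^ 3 * (Real.exp (1 / 2) * Real.exp (-r))) with hf₃
  have hm₁ : Measurable f₁ := (ENNReal.measurable_ofReal.comp (by fun_prop)).indicator measurableSet_Ioc
  have hm₂ : Measurable f₂ := (ENNReal.measurable_ofReal.comp (by fun_prop)).indicator measurableSet_Ioc
  -- pointwise domination on `(0, ∞)`
  have hpt : ∀ r ∈ Ioi (0 : ℝ), ENNReal.ofReal (r ^ 2) * ENNReal.ofReal (uprof Kr V β ρ r) ≤ f₁ r + f₂ r + f₃ r := by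
    intro r hr
    rw [Set.mem_Ioi] at hr
    rw [← ENNReal.ofReal_mul (sq_nonneg _)]
    unfold uprof
    have he : Real.exp (-r ^ 2 / 2) ≤ 1 := Real.exp_le_one_iff.2 (by nlinarith)
    by_cases h1 : r ≤ ρ
    · rw [if_pos h1]
      have : ENNReal.ofReal (r ^ 2 * (Real.exp (-r ^ 2 / 2) * (V * r ^ 9))) ≤ f₁ r := by
        rw [hf₁, indicator_of_mem (show r ∈ Ioc 0 ρ from ⟨hr, h1⟩)]
        refine ENNReal.ofReal_le_ofReal ?_
        have : 0 ≤ V * r ^ 11 := by positivity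
        nlinarith [mul_le_mul_of_nonneg_left he this]
      exact this.trans (by rw [add_assoc]; exact le_self_add)
    · rw [if_neg h1]
      push Not at h1
      have hval : r ^ 2 * (Real.exp (-r ^ 2 / 2) * (Kr / (r * β) ^ 3)) = Kr / β ^ 3 * (Real.exp (-r ^ 2 / 2) / r) := by
        field_simp
      rw [hval]
      by_cases h2 : r ≤ 1
      · have : ENNReal.ofReal (Kr / β ^ 3 * (Real.exp (-r ^ 2 / 2) / r)) ≤ f₂ r := by
          rw [hf₂, indicator_of_mem (show r ∈ Ioc ρ 1 from ⟨h1, h2⟩)]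
          refine ENNReal.ofReal_le_ofReal (mul_le_mul_of_nonneg_left ?_ (by positivity))
          rw [div_le_iff₀ hr, inv_mul_cancel₀ hr.ne']
          exact he
        calc _ ≤ f₂ r := this
          _ ≤ f₁ r + f₂ r := le_add_self
          _ ≤ f₁ r + f₂ r + f₃ r := le_self_add
      · push Not at h2
        have : ENNReal.ofReal (Kr / β ^ 3 * (Real.exp (-r ^ 2 / 2) / r)) ≤ f₃ r := by
          rw [hf₃]
          exact ENNReal.ofReal_le_ofReal
            (mul_le_mul_of_nonneg_left (exp_neg_sq_half_div_le h2.le) (by positivity))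
        exact this.trans le_add_self
  -- the three integrals
  have hI₁ : ∫⁻ r in Ioi (0 : ℝ), f₁ r ≤ ENNReal.ofReal (V * ρ ^ 12 / 12) := by
    calc ∫⁻ r in Ioi (0 : ℝ), f₁ r ≤ ∫⁻ r, f₁ r := setLIntegral_le_lintegral _ _
      _ = ∫⁻ r in Ioc 0 ρ, ENNReal.ofReal (V * r ^ 11) := by rw [hf₁, lintegral_indicator measurableSet_Ioc]
      _ = ENNReal.ofReal (∫ r in Ioc 0 ρ, V * r ^ 11) := by
          rw [← ofReal_integral_eq_lintegral_ofReal]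
          · exact (Continuous.integrableOn_Icc (by fun_prop)).mono_set Ioc_subset_Icc_self
          · exact (ae_restrict_iff' measurableSet_Ioc).2 (Filter.Eventually.of_forall fun r hr => by
              have := hr.1; positivity)
      _ = ENNReal.ofReal (V * ρ ^ 12 / 12) := by
          rw [← intervalIntegral.integral_of_le hρ.le, intervalIntegral.integral_const_mul, integral_pow]
          congr 1; ring
  have hI₂ : ∫⁻ r in Ioi (0 : ℝ), f₂ r ≤ ENNReal.ofReal (Kr / β ^ 3 * Real.log ρ⁻¹) := by
    calc ∫⁻ r in Ioi (0 : ℝ), f₂ r ≤ ∫⁻ r, f₂ r := setLIntegral_le_lintegral _ _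
      _ = ∫⁻ r in Ioc ρ 1, ENNReal.ofReal (Kr / β ^ 3 * r⁻¹) := by rw [hf₂, lintegral_indicator measurableSet_Ioc]
      _ = ENNReal.ofReal (∫ r in Ioc ρ 1, Kr / β ^ 3 * r⁻¹) := by
          rw [← ofReal_integral_eq_lintegral_ofReal]
          · refine (ContinuousOn.integrableOn_Icc ?_).mono_set Ioc_subset_Icc_self
            exact ContinuousOn.mul continuousOn_const
              (continuousOn_inv₀.mono fun r hr => ne_of_gt (hρ.trans_le hr.1))
          · exact (ae_restrict_iff' measurableSet_Ioc).2 (Filter.Eventually.of_forall fun r hr => by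
              have := hρ.trans hr.1; positivity)
      _ = ENNReal.ofReal (Kr / β ^ 3 * Real.log ρ⁻¹) := by
          rw [← intervalIntegral.integral_of_le hρ1, intervalIntegral.integral_const_mul,
            integral_inv_of_pos hρ zero_lt_one, one_div]
  have hI₃ : ∫⁻ r in Ioi (0 : ℝ), f₃ r = ENNReal.ofReal (Kr / β ^ 3 * Real.exp (1 / 2)) := by
    rw [hf₃, ← ofReal_integral_eq_lintegral_ofReal]
    · rw [integral_const_mul, integral_const_mul, integral_exp_neg_Ioi, neg_zero, Real.exp_zero, mul_one]
    · exact ((integrableOn_exp_neg_Ioi 0).const_mul _).const_mul _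
    · exact Filter.Eventually.of_forall fun r => by positivity
  calc ∫⁻ r in Ioi (0 : ℝ), ENNReal.ofReal (r ^ 2) * ENNReal.ofReal (uprof Kr V β ρ r)
      ≤ ∫⁻ r in Ioi (0 : ℝ), (f₁ r + f₂ r + f₃ r) := setLIntegral_mono' measurableSet_Ioi hpt
    _ = (∫⁻ r in Ioi (0 : ℝ), f₁ r) + (∫⁻ r in Ioi (0 : ℝ), f₂ r) + ∫⁻ r in Ioi (0 : ℝ), f₃ r := by
        rw [lintegral_add_left (f := fun r => f₁ r + f₂ r) (hm₁.add hm₂), lintegral_add_left hm₁]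
    _ ≤ ENNReal.ofReal (V * ρ ^ 12 / 12) + ENNReal.ofReal (Kr / β ^ 3 * Real.log ρ⁻¹) +
          ENNReal.ofReal (Kr / β ^ 3 * Real.exp (1 / 2)) := by
        gcongr
        exact hI₃.le
    _ = ENNReal.ofReal (V * ρ ^ 12 / 12 + Kr / β ^ 3 * (Real.log ρ⁻¹ + Real.exp (1 / 2))) := by
        have h1 : 0 ≤ V * ρ ^ 12 / 12 := by positivity
        have h2 : 0 ≤ Kr / β ^ 3 * Real.log ρ⁻¹ := by
          have : 0 ≤ Real.log ρ⁻¹ := Real.log_nonneg (one_le_inv_iff₀.2 ⟨hρ, hρ1⟩)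
          positivity
        have h3 : 0 ≤ Kr / β ^ 3 * Real.exp (1 / 2) := by positivity
        rw [← ENNReal.ofReal_add h1 h2, ← ENNReal.ofReal_add (add_nonneg h1 h2) h3]
        congr 1; ring

/-- ★ 1-D LOWER IDENTITY: `∫_{r>0} r² 𝟙_{[ρ', r₁]}(r) (rβ)⁻³ dr = β⁻³ log(r₁/ρ')` (`0 < ρ' ≤ r₁`). -/
theorem lintegral_lprof_eq {β ρ' r₁ : ℝ} (hβ : 0 < β) (hρ : 0 < ρ') (hρr : ρ' ≤ r₁) :
    ∫⁻ r in Ioi (0 : ℝ), ENNReal.ofReal (r ^ 2) * (Icc ρ' r₁).indicator (fun r => ENNReal.ofReal (((r * β) ^ 3)⁻¹)) r =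
      ENNReal.ofReal ((β ^ 3)⁻¹ * Real.log (r₁ / ρ')) := by
  have hr₁ : 0 < r₁ := hρ.trans_le hρr
  have heq : ∀ r : ℝ, ENNReal.ofReal (r ^ 2) * (Icc ρ' r₁).indicator (fun r => ENNReal.ofReal (((r * β) ^ 3)⁻¹)) r =
      (Icc ρ' r₁).indicator (fun r => ENNReal.ofReal ((β ^ 3)⁻¹ * r⁻¹)) r := by
    intro r
    by_cases hr : r ∈ Icc ρ' r₁
    · rw [indicator_of_mem hr, indicator_of_mem hr, ← ENNReal.ofReal_mul (sq_nonneg _)]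
      congr 1
      have : r ≠ 0 := (hρ.trans_le hr.1).ne'
      field_simp
    · rw [indicator_of_notMem hr, indicator_of_notMem hr, mul_zero]
  simp_rw [heq]
  rw [lintegral_indicator measurableSet_Icc, Measure.restrict_restrict measurableSet_Icc,
    show Icc ρ' r₁ ∩ Ioi 0 = Icc ρ' r₁ from Set.inter_eq_left.2 fun r hr => hρ.trans_le hr.1]
  rw [← ofReal_integral_eq_lintegral_ofReal]
  · congr 1
    rw [integral_Icc_eq_integral_Ioc, ← intervalIntegral.integral_of_le hρr, intervalIntegral.integral_const_mul,
      integral_inv_of_pos hρ hr₁]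
  · refine ContinuousOn.integrableOn_Icc (ContinuousOn.mul continuousOn_const ?_)
    exact continuousOn_inv₀.mono fun r hr => ne_of_gt (hρ.trans_le hr.1)
  · exact (ae_restrict_iff' measurableSet_Icc).2 (Filter.Eventually.of_forall fun r hr => by
      have := hρ.trans_le hr.1; positivity)


end Summit.QuantumFields.YangMills.Theorems.ToronValleyVolume.ZeroMode

end
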